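import Literature.Analysis.FluidPDE.ForcedFourierPicardLimit
import Literature.Analysis.FluidPDE.TaoH1FourierMildExists
import HarnessLib

/-!
# Tao (2011/2013), Thm. 5.4 (ii) WITH FORCE on the Fourier side: existence of a forced
# `H¹`-mild solution of Sobolev class (`IsSobolevMildForced`)

T. Tao, *Localisation and compactness properties of the Navier–Stokes global regularity problem*,
Anal. PDE 6 (2013) 25–107 = arXiv:1108.1165, Thm. 5.4 (ii) = arXiv Thm. 31 (ii), p. 18:
"If `(‖u₀‖_{H¹_x(ℝ³)} + ‖f‖_{L¹_t H¹_x(ℝ³)})⁴ T ≤ c` for a sufficiently small absolute constant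
`c > 0`, then there exists a `H¹` mild solution `(u, p, u₀, f, T)` with the indicated data" —
proved "by repeating the proof of Theorem 28 verbatim", i.e. by the contraction of the Duhamel
map WITH the forcing term `∫₀ᵗ e^{(t-t')Δ} P f(t') dt'` (Duhamel formula (7), p. 3) in
`X¹ = L^∞_t H¹_x ∩ L²_t H²_x` (p. 16), closed by the energy estimate (energy-duh2) and the
bilinear estimate of Lemma 2.1 = arXiv Lemma 23 (p. 10).

This file is the seventh and last file of the FORCED twin of the tree's weighted-`L²`
Fourier-side construction (`ForcedFourierDuhamelDefs → ForcedFourierDuhamelForcing(Measurable) →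
ForcedFourierPicardBounds → …Weighted → …Cauchy → …Limit`; homogeneous twin
`TaoH1FourierMildExists`). It assembles the Fourier-side EXISTENCE THEOREM consumed by the
physical-space assembly of `tao2011_smooth_local_existence_forced`
(`TaoH1LocalExistenceForcedAssembly`): for `ν > 0`, `T > 0`, a Fourier datum `a` of Sobolev class
and force coefficients `b` in the WIDE class — jointly measurable, continuous in time at each
frequency, with pointwise decay of every order uniformly in time, divergence free and conjugation
symmetric (this is the class of the Leray-PROJECTED transform `P(ξ) 𝓕(f(t))(ξ)` of a
Schwartz-on-slab force, which is discontinuous at `ξ = 0` unless `∫ f(t, x) dx = 0`) — with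
`fourierH1Sq a ≤ A`, `fourierH1Sq (b t) ≤ B` on `[0, T]` and the smallness condition
`(A + T² B)² T ≤ c₀ ν³` (`A ~ ‖u₀‖²_{H¹}`, `B ~ sup_t ‖Pf(t)‖²_{H¹}`, so that
`(A + T²B)² T ≤ (‖u₀‖_{H¹} + T sup_t‖f(t)‖_{H¹})⁴ T`: Tao's hypothesis with
`‖f‖_{L¹_t H¹_x} ≤ T sup_t ‖f(t)‖_{H¹}`, at viscosity `ν` by the footnote-3 rescaling), the
pointwise limit `v = picardLimitForced (4π²ν) T a b` of the forced Picard scheme is an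
`IsSobolevMildForced (4π²ν) T a b v`.

* `lintegral_norm_sq_mul_majorant_sq_lt_top` — the `Ḣ²`-type majorant moment of a Sobolev datum is
  finite; `lintegral_norm_sq_mul_majorant_sq_le_of_hasDecay` — and, for the force, bounded
  uniformly in time by the uniform decay;
* `picardSmallConstForced_ne_top`, `picard_smallness_forced` — the scheme's constant is finite and
  `(A + T²B)² T ≤ c₀ ν³`, `c₀ = 1024 π¹⁰ / (6561 C² + 1)`, implies the scheme's condition `hs`
  with `δ₁ = (9/(4π²)) (A + 9 T² B)`;
* `tao2011_sobolevMildForced_exists` — the existence theorem (a THEOREM; no definition, no named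
  fact is introduced).

## Mathlib / tree search

Tree: `picardLimitForced_eq_duhamelForced`, `aestronglyMeasurable_picardLimitForced`,
`continuous_hsub_picardLimitForced_time`, `exists_hasDecay_hsub_picardLimitForced`,
`sum_mul_picardLimitForced`, `picardLimitForced_conj_symm` (`ForcedFourierPicardLimit`),
`lintegral_weight_majorant_forcing_sq_le_of_sup'`, `lintegral_time_weight_majorant_forcing_sq_le_of_sup'`
(`ForcedFourierDuhamelForcingMeasurable`), `lintegral_norm_mul_majorant_sq_le_fourierH1Sq`,
`IsSobolevFourierDatum.lintegral_weight_apply_sq_lt_top` (`TaoH1FourierMildExists`),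
`lintegral_weight_majorant_sq_le_of_hasDecay`, `class_duhamelIntegral'.lintegral_weight_majorant_sq_le'`
(`FourierL2PicardClass`), `lintegral_weight_inv_sq_lt_top` (`FourierL2Convolution`),
`finrank_three_lt_four` (`FourierL2DuhamelStep`). Mathlib: `ENNReal.ofReal_rpow_of_nonneg`,
`sq_le_one_iff₀`, `Real.sq_sqrt`.

## References

* T. Tao, arXiv:1108.1165 = Anal. PDE 6 (2013): (7) p. 3, Lemma 2.1 = arXiv Lemma 23 (p. 10),
  Thm. 5.4 (ii) = arXiv Thm. 31 (ii) (p. 18) with the proof of Thm. 5.1 = arXiv Thm. 28 (p. 16),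
  footnote 3 (p. 4). [Tao2011]
* J. Leray, Acta Math. 63 (1934), §19 (successive approximations). [Leray1934]
-/

noncomputable section

open MeasureTheory Set Function Filter Real Complex
open scoped ENNReal NNReal ComplexConjugate
open _root_.Topology

namespace Literature.Analysis.FluidPDE

open FourierNS

/-! ### Finiteness of the second-order majorant moments -/

namespace FourierNS

/-- **The `Ḣᵏ`-type majorant moment of a Sobolev datum is finite**:
`∫ (‖η‖ᵏ ∑ⱼ |aⱼ(η)|)² dη < ∞` (`‖η‖ᵏ ≤ (1+‖η‖)ᵏ`, `(∑ⱼ xⱼ)² ≤ card ∑ⱼ xⱼ²` and the componentwise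
moments of `IsSobolevFourierDatum`). [cite: Tao2011, Thm. 5.4 (ii) (arXiv Thm. 31 (ii)), `H¹` data p. 6] -/
theorem lintegral_norm_pow_mul_majorant_sq_lt_top {a : EuclideanSpace ℝ (Fin 3) → Fin 3 → ℂ}
    (ha : IsSobolevFourierDatum a) (k : ℕ) :
    ∫⁻ η, (ENNReal.ofReal (‖η‖ ^ k) * ∑ j, ‖a η j‖ₑ) ^ 2 < ⊤ := by
  have h1 : ∫⁻ η, (ENNReal.ofReal (‖η‖ ^ k) * ∑ j, ‖a η j‖ₑ) ^ 2 ≤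
      ∫⁻ η, (ENNReal.ofReal ((1 + ‖η‖) ^ k) * ∑ j, ‖a η j‖ₑ) ^ 2 := by
    refine lintegral_mono fun η => ?_
    have hle : ENNReal.ofReal (‖η‖ ^ k) ≤ ENNReal.ofReal ((1 + ‖η‖) ^ k) :=
      ENNReal.ofReal_le_ofReal (pow_le_pow_left₀ (norm_nonneg _) (by linarith [norm_nonneg η]) k)
    exact pow_le_pow_left' (mul_le_mul' hle le_rfl) 2
  refine lt_of_le_of_lt (h1.trans (class_duhamelIntegral'.lintegral_weight_majorant_sq_le' ha.meas k)) ?_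
  exact ENNReal.mul_lt_top (by simp) (ENNReal.sum_lt_top.2 fun j _ =>
    ha.lintegral_weight_apply_sq_lt_top k j)

/-- **Uniform-in-time bound of the `Ḣ²`-type majorant moment of the force from its uniform
decay**: if `HasDecay 4 B (b s)` for all `s` then
`∫ (‖η‖² ∑ⱼ |bⱼ(s, η)|)² dη ≤ (card · B)² ∫ (1+‖η‖)⁻⁴ < ∞` for all `s`.
[cite: Tao2011, Thm. 5.4 (ii) (arXiv Thm. 31 (ii)), Schwartz data p. 3] -/
theorem lintegral_norm_sq_mul_majorant_sq_le_of_hasDecay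
    {b : ℝ → EuclideanSpace ℝ (Fin 3) → Fin 3 → ℂ} {B : ℝ} (hb : ∀ s, HasDecay 4 B (b s)) (s : ℝ) :
    ∫⁻ η, (ENNReal.ofReal (‖η‖ ^ 2) * ∑ j, ‖b s η j‖ₑ) ^ 2 ≤
      ((Fintype.card (Fin 3) : ℝ≥0∞) * ENNReal.ofReal B) ^ 2 *
        ∫⁻ η : EuclideanSpace ℝ (Fin 3), (ENNReal.ofReal ((1 + ‖η‖) ^ 2))⁻¹ ^ 2 := by
  have h1 : ∫⁻ η, (ENNReal.ofReal (‖η‖ ^ 2) * ∑ j, ‖b s η j‖ₑ) ^ 2 ≤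
      ∫⁻ η, (ENNReal.ofReal ((1 + ‖η‖) ^ 2) * ∑ j, ‖b s η j‖ₑ) ^ 2 := by
    refine lintegral_mono fun η => ?_
    have hle : ENNReal.ofReal (‖η‖ ^ 2) ≤ ENNReal.ofReal ((1 + ‖η‖) ^ 2) :=
      ENNReal.ofReal_le_ofReal (pow_le_pow_left₀ (norm_nonneg _) (by linarith [norm_nonneg η]) 2)
    exact pow_le_pow_left' (mul_le_mul' hle le_rfl) 2
  exact h1.trans (lintegral_weight_majorant_sq_le_of_hasDecay (k := 2) (m := 2) (hb s))

end FourierNS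

/-! ### The smallness condition of the forced scheme from `(A + T²B)² T ≤ c₀ ν³` -/

/-- **The constant of the forced weighted-`L²` Picard scheme is finite**: the absolute `ℝ≥0∞`
constant `36864 · (4π · 3²)² · ((S · 2π)^{3/2})²` of the smallness condition of
`ForcedFourierPicardBounds` … `ForcedFourierPicardLimit` (`S` Mathlib's Sobolev constant
`SNormLESNormFDerivOfEqConst ℂ volume 2` on `ℝ³`) is not `⊤`.
[cite: Tao2011, Thm. 5.4 (ii) (arXiv Thm. 31 (ii)); proof of Thm. 5.1 (arXiv Thm. 28, p. 16)] -/
theorem picardSmallConstForced_ne_top :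
    (36864 * (ENNReal.ofReal (4 * π) * (Fintype.card (Fin 3) : ℝ≥0∞) ^ 2) ^ 2 *
      ((SNormLESNormFDerivOfEqConst ℂ (volume : Measure (EuclideanSpace ℝ (Fin 3))) 2 *
        ENNReal.ofReal (2 * π)) ^ (3 / 2 : ℝ)) ^ 2 : ℝ≥0∞) ≠ ⊤ := by
  refine ENNReal.mul_ne_top (ENNReal.mul_ne_top (by norm_num) (ENNReal.pow_ne_top ?_))
    (ENNReal.pow_ne_top ?_)
  · exact ENNReal.mul_ne_top ENNReal.ofReal_ne_top (ENNReal.pow_ne_top (ENNReal.natCast_ne_top _))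
  · exact ENNReal.rpow_ne_top_of_nonneg (by norm_num)
      (ENNReal.mul_ne_top ENNReal.coe_ne_top ENNReal.ofReal_ne_top)

/-- **Smallness, forced form.** For a finite constant `C`, `ν > 0`, `T > 0`, `A, B ≥ 0` and
`(A + T² B)² T ≤ c₀ ν³` with `c₀ = 1024 π¹⁰ / (6561 C² + 1)` (`C` taken as a real number), the
condition `hs` of the forced weighted-`L²` Picard scheme holds with `c = 4π²ν` and
`δ₁ = (9/(4π²)) (A + 9 T² B)`:
`C · c⁻¹ · (T c⁻¹)^{1/2} · δ₁ ≤ 1` (square: `C² c⁻³ T (9/(4π²))² (A + 9T²B)² ≤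
6561 C² T (A + T²B)² / (1024 π¹⁰ ν³) ≤ 1`).
[cite: Tao2011, Thm. 5.4 (ii) (arXiv Thm. 31 (ii), the smallness hypothesis; footnote 3)] -/
theorem picard_smallness_forced {C : ℝ≥0∞} (hCtop : C ≠ ⊤) {ν T A B : ℝ}
    (hν : 0 < ν) (hT : 0 < T) (hA : 0 ≤ A) (hB : 0 ≤ B)
    (hsmall : (A + T ^ 2 * B) ^ 2 * T ≤ 1024 * π ^ 10 / (6561 * C.toReal ^ 2 + 1) * ν ^ 3) :
    C * ENNReal.ofReal (4 * π ^ 2 * ν)⁻¹ *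
        (ENNReal.ofReal T * ENNReal.ofReal (4 * π ^ 2 * ν)⁻¹) ^ (1 / 2 : ℝ) *
        ENNReal.ofReal (9 / (4 * π ^ 2) * (A + 9 * T ^ 2 * B)) ≤ 1 := by
  set c : ℝ := 4 * π ^ 2 * ν with hc
  have hcpos : 0 < c := by positivity
  set Cr : ℝ := C.toReal with hCr
  have hCr0 : 0 ≤ Cr := ENNReal.toReal_nonneg
  have hC : C = ENNReal.ofReal Cr := by rw [hCr, ENNReal.ofReal_toReal hCtop]
  -- the time factor
  have hroot : (ENNReal.ofReal T * ENNReal.ofReal c⁻¹) ^ (1 / 2 : ℝ) =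
      ENNReal.ofReal (Real.sqrt (T * c⁻¹)) := by
    rw [← ENNReal.ofReal_mul hT.le, ENNReal.ofReal_rpow_of_nonneg (by positivity) (by norm_num),
      Real.sqrt_eq_rpow]
  -- the real quantity
  set r : ℝ := Cr * c⁻¹ * Real.sqrt (T * c⁻¹) * (9 / (4 * π ^ 2) * (A + 9 * T ^ 2 * B)) with hr
  have hr0 : 0 ≤ r := by positivity
  have hr2 : r ^ 2 = 81 * Cr ^ 2 * (A + 9 * T ^ 2 * B) ^ 2 * T / (1024 * π ^ 10 * ν ^ 3) := by
    have hs2 : Real.sqrt (T * c⁻¹) ^ 2 = T * c⁻¹ := Real.sq_sqrt (by positivity)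
    have hπ : (π : ℝ) ≠ 0 := Real.pi_pos.ne'
    have hν0 : ν ≠ 0 := hν.ne'
    simp only [hr]
    rw [mul_pow, mul_pow, mul_pow, hs2, hc]
    field_simp
    ring
  have hr1 : r ≤ 1 := by
    rw [← sq_le_one_iff₀ hr0, hr2, div_le_one (by positivity)]
    have hden : 0 < 6561 * Cr ^ 2 + 1 := by positivity
    have h1 : (A + T ^ 2 * B) ^ 2 * T * (6561 * Cr ^ 2 + 1) ≤ 1024 * π ^ 10 * ν ^ 3 := by
      have := hsmall
      rw [div_mul_eq_mul_div, le_div_iff₀ hden] at this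
      linarith
    -- `(A + 9T²B)² ≤ 81 (A + T²B)²`
    have h9 : (A + 9 * T ^ 2 * B) ^ 2 ≤ 81 * (A + T ^ 2 * B) ^ 2 := by
      have hx : 0 ≤ A + T ^ 2 * B := by positivity
      have hle : A + 9 * T ^ 2 * B ≤ 9 * (A + T ^ 2 * B) := by nlinarith [hA, hB, sq_nonneg T]
      have h0 : 0 ≤ A + 9 * T ^ 2 * B := by positivity
      nlinarith [hle, h0, hx]
    have h2 : 0 ≤ Cr ^ 2 * T := by positivity
    have h3 : 0 ≤ (A + T ^ 2 * B) ^ 2 * T := by positivity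
    nlinarith [h1, h9, h2, h3, mul_le_mul_of_nonneg_left h9 h2]
  -- assemble in `ℝ≥0∞`
  rw [hC, hroot]
  calc ENNReal.ofReal Cr * ENNReal.ofReal c⁻¹ * ENNReal.ofReal (Real.sqrt (T * c⁻¹)) *
        ENNReal.ofReal (9 / (4 * π ^ 2) * (A + 9 * T ^ 2 * B))
      = ENNReal.ofReal r := by
        rw [hr, ← ENNReal.ofReal_mul (p := Cr) (q := c⁻¹) hCr0,
          ← ENNReal.ofReal_mul (p := Cr * c⁻¹) (q := Real.sqrt (T * c⁻¹)) (by positivity),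
          ← ENNReal.ofReal_mul (p := Cr * c⁻¹ * Real.sqrt (T * c⁻¹))
            (q := 9 / (4 * π ^ 2) * (A + 9 * T ^ 2 * B)) (by positivity)]
    _ ≤ 1 := ENNReal.ofReal_le_one.2 hr1

/-! ### The existence theorem -/

/-- **Tao 2011, Thm. 5.4 (ii) WITH FORCE, Fourier side: existence of a forced `H¹`-mild solution of
Sobolev class.** There is an absolute constant `c₀ > 0` (`= 1024 π¹⁰ / (6561 C² + 1)`, `C` the real
value of the constant of the forced weighted-`L²` Picard scheme, `picardSmallConstForced_ne_top`)
such that: for `ν > 0`, `T > 0`, a Fourier datum `a` of Sobolev class (`IsSobolevFourierDatum`: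
measurable, weighted square moments of every order, divergence free, conjugation symmetric), force
coefficients `b : ℝ → ℝ³ → (Fin 3 → ℂ)` that are jointly measurable, continuous in time at each
frequency, with pointwise decay of every order uniformly in time, divergence free
(`∑ₗ ξₗ bₗ(t, ξ) = 0`) and conjugation symmetric — the class of the Leray-projected transform
`P(ξ)𝓕(f(t))(ξ)` of a Schwartz-on-slab force `f` — and sizes `A, B ≥ 0` with
`fourierH1Sq a ≤ A` (`= ‖u₀‖²_{H¹}`), `fourierH1Sq (b t) ≤ B` for `t ∈ [0, T]`
(`≤ sup_t ‖f(t)‖²_{H¹}`) and `(A + T² B)² T ≤ c₀ ν³` (implied by Tao's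
`(‖u₀‖_{H¹} + ‖f‖_{L¹_t H¹_x})⁴ T ≤ c` in the form `(A^{1/2} + T B^{1/2})⁴ T ≤ c₀ ν³`, since
`A + T²B ≤ (A^{1/2} + T B^{1/2})²`; viscosity by footnote 3), there is a Fourier-side forced mild
solution `v` on `[0, T]`: `IsSobolevMildForced (4π²ν) T a b v` — measurable slices, continuity in
time at every frequency, the forced Duhamel identity
`v(t) = heat(t) • a + ∫₀ᵗ heat(t-s) • b(s) ds − ∫₀ᵗ heat(t-s) • N(v(s), v(s)) ds` (Tao's (7)) at
every `(t, ξ)`, decay of every order of `v − heat • a` uniformly in time, the divergence-free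
relation and the conjugation symmetry. The solution is the pointwise limit
`picardLimitForced (4π²ν) T a b` of the forced Picard scheme (`ForcedFourierPicardLimit`), the
Fourier-side run of Tao's `X¹` contraction "repeating the proof of Theorem 28 verbatim" with the
force. [cite: Tao2011, Thm. 5.4 (ii) (arXiv Thm. 31 (ii), p. 18; (7) p. 3; proof of Thm. 28,
p. 16; Lemma 23, p. 10)] -/
theorem tao2011_sobolevMildForced_exists :
    ∃ c₀ : ℝ, 0 < c₀ ∧ ∀ ⦃ν T : ℝ⦄, 0 < ν → 0 < T →
      ∀ ⦃a : EuclideanSpace ℝ (Fin 3) → Fin 3 → ℂ⦄, IsSobolevFourierDatum a →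
      ∀ ⦃b : ℝ → EuclideanSpace ℝ (Fin 3) → Fin 3 → ℂ⦄, Measurable (uncurry b) →
        (∀ ξ, Continuous fun t => b t ξ) → (∀ K : ℕ, ∃ B : ℝ, ∀ t, HasDecay K B (b t)) →
        (∀ t ξ, ∑ l, ((ξ l : ℝ) : ℂ) * b t ξ l = 0) → (∀ t ξ l, b t (-ξ) l = conj (b t ξ l)) →
      ∀ ⦃A B : ℝ⦄, 0 ≤ A → 0 ≤ B → fourierH1Sq a ≤ ENNReal.ofReal A →
        (∀ t ∈ Icc 0 T, fourierH1Sq (b t) ≤ ENNReal.ofReal B) →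
        (A + T ^ 2 * B) ^ 2 * T ≤ c₀ * ν ^ 3 →
        ∃ v : ℝ → EuclideanSpace ℝ (Fin 3) → Fin 3 → ℂ, IsSobolevMildForced (4 * π ^ 2 * ν) T a b v := by
  refine ⟨1024 * π ^ 10 / (6561 * ENNReal.toReal
    (36864 * (ENNReal.ofReal (4 * π) * (Fintype.card (Fin 3) : ℝ≥0∞) ^ 2) ^ 2 *
      ((SNormLESNormFDerivOfEqConst ℂ (volume : Measure (EuclideanSpace ℝ (Fin 3))) 2 *
        ENNReal.ofReal (2 * π)) ^ (3 / 2 : ℝ)) ^ 2 : ℝ≥0∞) ^ 2 + 1), by positivity, ?_⟩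
  intro ν T hν hT a ha b hbm hbt hbd hbdiv hbconj A B hA hB hH1a hH1b hsmall
  have hs := picard_smallness_forced picardSmallConstForced_ne_top hν hT hA hB hsmall
  set c : ℝ := 4 * π ^ 2 * ν with hc
  have hcpos : 0 < c := by positivity
  have ham : AEStronglyMeasurable a volume := ha.meas
  have haw : ∀ (k : ℕ) (j : Fin 3), ∫⁻ η, (ENNReal.ofReal ((1 + ‖η‖) ^ k) * ‖a η j‖ₑ) ^ 2 < ⊤ :=
    fun k j => ha.lintegral_weight_apply_sq_lt_top k j
  -- the sizes `δ₁`, `δ₂`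
  set δ₁ : ℝ≥0∞ := ENNReal.ofReal (9 / (4 * π ^ 2) * (A + 9 * T ^ 2 * B)) with hδ₁
  have hδ₁top : δ₁ < ⊤ := ENNReal.ofReal_lt_top
  obtain ⟨B₄, hB₄⟩ := hbd 4
  set I₂ : ℝ≥0∞ := ∫⁻ η : EuclideanSpace ℝ (Fin 3), (ENNReal.ofReal ((1 + ‖η‖) ^ 2))⁻¹ ^ 2 with hI₂
  have hI₂top : I₂ < ⊤ := lintegral_weight_inv_sq_lt_top finrank_three_lt_four
  set β₂ : ℝ≥0∞ := ((Fintype.card (Fin 3) : ℝ≥0∞) * ENNReal.ofReal B₄) ^ 2 * I₂ with hβ₂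
  have hβ₂top : β₂ < ⊤ :=
    ENNReal.mul_lt_top (ENNReal.pow_lt_top (ENNReal.mul_lt_top (by simp) ENNReal.ofReal_lt_top)) hI₂top
  set α₂ : ℝ≥0∞ := ∫⁻ η, (ENNReal.ofReal (‖η‖ ^ 2) * ∑ j, ‖a η j‖ₑ) ^ 2 with hα₂
  have hα₂top : α₂ < ⊤ := lintegral_norm_pow_mul_majorant_sq_lt_top ha 2
  set δ₂ : ℝ≥0∞ := α₂ + 9 * ENNReal.ofReal T ^ 2 * β₂ with hδ₂
  have hδ₂top : δ₂ < ⊤ := ENNReal.add_lt_top.2 ⟨hα₂top, ENNReal.mul_lt_top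
    (ENNReal.mul_lt_top (by norm_num) (ENNReal.pow_lt_top ENNReal.ofReal_lt_top)) hβ₂top⟩
  -- the datum moments
  have hα₁ : ∫⁻ η, (ENNReal.ofReal ‖η‖ * ∑ j, ‖a η j‖ₑ) ^ 2 ≤ δ₁ := by
    calc ∫⁻ η, (ENNReal.ofReal ‖η‖ * ∑ j, ‖a η j‖ₑ) ^ 2
        ≤ ENNReal.ofReal (9 / (4 * π ^ 2)) * fourierH1Sq a := lintegral_norm_mul_majorant_sq_le_fourierH1Sq a
      _ ≤ ENNReal.ofReal (9 / (4 * π ^ 2)) * ENNReal.ofReal A := mul_le_mul' le_rfl hH1a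
      _ = ENNReal.ofReal (9 / (4 * π ^ 2) * A) := (ENNReal.ofReal_mul (by positivity)).symm
      _ ≤ δ₁ := ENNReal.ofReal_le_ofReal
          (mul_le_mul_of_nonneg_left (le_add_of_nonneg_right (by positivity)) (by positivity))
  have hα₂le : ∫⁻ η, (ENNReal.ofReal (‖η‖ ^ 2) * ∑ j, ‖a η j‖ₑ) ^ 2 ≤ δ₂ := le_self_add
  -- the force moments: sup in time of the `Ḣ¹`- and `Ḣ²`-type majorant moments of `b`
  have hb1 : ∀ s ∈ Ioc 0 T, ∫⁻ η, (ENNReal.ofReal ‖η‖ * ∑ j, ‖b s η j‖ₑ) ^ 2 ≤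
      ENNReal.ofReal (9 / (4 * π ^ 2) * B) := fun s hs' => by
    calc ∫⁻ η, (ENNReal.ofReal ‖η‖ * ∑ j, ‖b s η j‖ₑ) ^ 2
        ≤ ENNReal.ofReal (9 / (4 * π ^ 2)) * fourierH1Sq (b s) :=
          lintegral_norm_mul_majorant_sq_le_fourierH1Sq (b s)
      _ ≤ ENNReal.ofReal (9 / (4 * π ^ 2)) * ENNReal.ofReal B :=
          mul_le_mul' le_rfl (hH1b s ⟨hs'.1.le, hs'.2⟩)
      _ = ENNReal.ofReal (9 / (4 * π ^ 2) * B) := (ENNReal.ofReal_mul (by positivity)).symm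
  have hb2 : ∀ s ∈ Ioc 0 T, ∫⁻ η, (ENNReal.ofReal (‖η‖ ^ 2) * ∑ j, ‖b s η j‖ₑ) ^ 2 ≤ β₂ :=
    fun s _ => lintegral_norm_sq_mul_majorant_sq_le_of_hasDecay hB₄ s
  have hW1 : Measurable fun η : EuclideanSpace ℝ (Fin 3) => ENNReal.ofReal ‖η‖ :=
    (ENNReal.continuous_ofReal.comp continuous_norm).measurable
  have hW2 : Measurable fun η : EuclideanSpace ℝ (Fin 3) => ENNReal.ofReal (‖η‖ ^ 2) :=
    (ENNReal.continuous_ofReal.comp (continuous_norm.pow 2)).measurable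
  have hcard : ((Fintype.card (Fin 3) : ℝ≥0∞)) ^ 2 = 9 := by norm_num
  have hcinv : ENNReal.ofReal (1 / (2 * c)) ≤ ENNReal.ofReal c⁻¹ :=
    ENNReal.ofReal_le_ofReal (by rw [one_div]; exact inv_anti₀ hcpos (by linarith))
  -- `9 T² · (9/(4π²)) B ≤ δ₁`
  have h9T : 9 * ENNReal.ofReal T ^ 2 * ENNReal.ofReal (9 / (4 * π ^ 2) * B) ≤ δ₁ := by
    rw [show (9 : ℝ≥0∞) = ENNReal.ofReal 9 by norm_num, ← ENNReal.ofReal_pow hT.le,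
      ← ENNReal.ofReal_mul (by norm_num), ← ENNReal.ofReal_mul (by positivity)]
    refine ENNReal.ofReal_le_ofReal ?_
    have : 0 ≤ 9 / (4 * π ^ 2) * A := by positivity
    nlinarith [this]
  have hF₁ : ∀ t ∈ Icc 0 T, ∫⁻ η, (ENNReal.ofReal ‖η‖ * ∑ j, ‖forcing c T b t η j‖ₑ) ^ 2 ≤ δ₁ := by
    intro t _
    calc ∫⁻ η, (ENNReal.ofReal ‖η‖ * ∑ j, ‖forcing c T b t η j‖ₑ) ^ 2
        ≤ (Fintype.card (Fin 3) : ℝ≥0∞) ^ 2 * ENNReal.ofReal T ^ 2 *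
            ENNReal.ofReal (9 / (4 * π ^ 2) * B) :=
          lintegral_weight_majorant_forcing_sq_le_of_sup' hcpos.le hT.le hbm hbt hW1 hb1 t
      _ = 9 * ENNReal.ofReal T ^ 2 * ENNReal.ofReal (9 / (4 * π ^ 2) * B) := by rw [hcard]
      _ ≤ δ₁ := h9T
  have hG₁ : ∫⁻ t in Ioc 0 T, ∫⁻ η, (ENNReal.ofReal (‖η‖ ^ 2) *
      ∑ j, ‖forcing c T b t η j‖ₑ) ^ 2 ≤ ENNReal.ofReal c⁻¹ * δ₁ := by
    have h := lintegral_time_weight_majorant_forcing_sq_le_of_sup' (T := T) hcpos hbm hbt 1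
      (β := ENNReal.ofReal (9 / (4 * π ^ 2) * B)) (fun s hs' => by simpa only [pow_one] using hb1 s hs')
    simp only [show (1 : ℕ) + 1 = 2 from rfl] at h
    calc ∫⁻ t in Ioc 0 T, ∫⁻ η, (ENNReal.ofReal (‖η‖ ^ 2) * ∑ j, ‖forcing c T b t η j‖ₑ) ^ 2
        ≤ (Fintype.card (Fin 3) : ℝ≥0∞) ^ 2 * ENNReal.ofReal (1 / (2 * c)) * ENNReal.ofReal T ^ 2 *
            ENNReal.ofReal (9 / (4 * π ^ 2) * B) := h
      _ = ENNReal.ofReal (1 / (2 * c)) * (9 * ENNReal.ofReal T ^ 2 *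
            ENNReal.ofReal (9 / (4 * π ^ 2) * B)) := by rw [hcard]; ring
      _ ≤ ENNReal.ofReal c⁻¹ * δ₁ := mul_le_mul' hcinv h9T
  have h9T₂ : 9 * ENNReal.ofReal T ^ 2 * β₂ ≤ δ₂ := le_add_self
  have hF₂ : ∀ t ∈ Icc 0 T, ∫⁻ η, (ENNReal.ofReal (‖η‖ ^ 2) *
      ∑ j, ‖forcing c T b t η j‖ₑ) ^ 2 ≤ δ₂ := by
    intro t _
    calc ∫⁻ η, (ENNReal.ofReal (‖η‖ ^ 2) * ∑ j, ‖forcing c T b t η j‖ₑ) ^ 2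
        ≤ (Fintype.card (Fin 3) : ℝ≥0∞) ^ 2 * ENNReal.ofReal T ^ 2 * β₂ :=
          lintegral_weight_majorant_forcing_sq_le_of_sup' hcpos.le hT.le hbm hbt hW2 hb2 t
      _ = 9 * ENNReal.ofReal T ^ 2 * β₂ := by rw [hcard]
      _ ≤ δ₂ := h9T₂
  have hG₂ : ∫⁻ t in Ioc 0 T, ∫⁻ η, (ENNReal.ofReal (‖η‖ ^ 3) *
      ∑ j, ‖forcing c T b t η j‖ₑ) ^ 2 ≤ ENNReal.ofReal c⁻¹ * δ₂ := by
    have h := lintegral_time_weight_majorant_forcing_sq_le_of_sup' (T := T) hcpos hbm hbt 2 hb2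
    calc ∫⁻ t in Ioc 0 T, ∫⁻ η, (ENNReal.ofReal (‖η‖ ^ 3) * ∑ j, ‖forcing c T b t η j‖ₑ) ^ 2
        ≤ (Fintype.card (Fin 3) : ℝ≥0∞) ^ 2 * ENNReal.ofReal (1 / (2 * c)) * ENNReal.ofReal T ^ 2 *
            β₂ := h
      _ = ENNReal.ofReal (1 / (2 * c)) * (9 * ENNReal.ofReal T ^ 2 * β₂) := by rw [hcard]; ring
      _ ≤ ENNReal.ofReal c⁻¹ * δ₂ := mul_le_mul' hcinv h9T₂
  -- the limit of the forced Picard scheme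
  refine ⟨picardLimitForced c T a b, ?_⟩
  exact
    { meas := fun t => aestronglyMeasurable_picardLimitForced hcpos hT.le ham haw hbm hbt hbd hδ₁top
        hδ₂top hα₁ hα₂le hF₁ hG₁ hF₂ hG₂ hs t
      cont := fun ξ => by
        have h1 : Continuous fun t : ℝ => heat c ξ (clamp T t) • a ξ :=
          (continuous_heat_comp c continuous_const (continuous_clamp T)).smul continuous_const
        have h2 : Continuous fun t : ℝ => heat c ξ (clamp T t) • a ξ - picardLimitForced c T a b t ξ :=
          continuous_hsub_picardLimitForced_time hcpos hT.le ham haw hbm hbt hbd hδ₁top hδ₂top hα₁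
            hα₂le hF₁ hG₁ hF₂ hG₂ hs ξ
        have heq : (fun t : ℝ => picardLimitForced c T a b t ξ) = fun t =>
            heat c ξ (clamp T t) • a ξ -
              (heat c ξ (clamp T t) • a ξ - picardLimitForced c T a b t ξ) := by
          funext t; rw [sub_sub_cancel]
        rw [heq]
        exact h1.sub h2
      fixed := fun t ξ => picardLimitForced_eq_duhamelForced hcpos hT.le ham haw hbm hbt hbd hδ₁top
        hδ₂top hα₁ hα₂le hF₁ hG₁ hF₂ hG₂ hs t ξ
      decay := fun K => by
        obtain ⟨B', hB'⟩ := exists_hasDecay_hsub_picardLimitForced hcpos hT.le ham haw hbm hbt hbd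
          hδ₁top hδ₂top hα₁ hα₂le hF₁ hG₁ hF₂ hG₂ hs K
        refine ⟨B', fun t ξ => ?_⟩
        have h := hB' t ξ
        have hw : (0 : ℝ) < (1 + ‖ξ‖) ^ K := by positivity
        rw [norm_sub_rev]
        calc (1 + ‖ξ‖) ^ K * ‖heat c ξ (clamp T t) • a ξ - picardLimitForced c T a b t ξ‖
            ≤ (1 + ‖ξ‖) ^ K * (B' * ((1 + ‖ξ‖) ^ K)⁻¹) := mul_le_mul_of_nonneg_left h hw.le
          _ = B' := by field_simp
      divFree := fun t ξ => sum_mul_picardLimitForced hcpos hT.le ham haw hbm hbt hbd hδ₁top hδ₂top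
        hα₁ hα₂le hF₁ hG₁ hF₂ hG₂ hs ha.divFree hbdiv t ξ
      conjSymm := fun t ξ l => picardLimitForced_conj_symm hcpos hT.le ham haw hbm hbt hbd hδ₁top
        hδ₂top hα₁ hα₂le hF₁ hG₁ hF₂ hG₂ hs ha.conjSymm hbconj t ξ l }

end Literature.Analysis.FluidPDE

end
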